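import Mathlib.FieldTheory.RatFunc.Degree
import Literature.NumberTheory.Automorphic.GodementJacquetLocal
import Literature.RepresentationTheory.Semisimple.Multiplicity
import HarnessLib

/-!
# Local Rankin–Selberg factors: uniqueness of `L`, `γ` and `ε` (proved)

Companion to `RankinSelbergLocal` (Jacquet–Piatetski-Shapiro–Shalika 1983, §2, Thm. 2.7;
Cogdell, *Analytic theory of `L`-functions for `GL_n`*, §3.1, Thms. 3.1–3.2). That file states
the three "existence and uniqueness" results of the non-archimedean local theory of
`GL_n × GL_m`, `m < n`, as named facts `existsUnique_hasRSLFactor` (`∃! P`, the `L`-polynomial),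
`existsUnique_hasRSGamma` (`∃! γ`, the local functional equation) and
`existsUnique_hasRSEpsilon` (`∃! (e, a)`, `ε(s, π × π', ψ) = e q^{-as}`), for the predicates
`HasRSLFactor`, `HasRSGamma`, `HasRSEpsilon`. This file PROVES the uniqueness halves by pure
algebra of rational functions of `T = q^{-s}`, reducing each `∃!` to bare existence:

* `EqOnRightHalfPlane.unique`, `EqOnLeftHalfPlane.unique`: a rational function is determined by
  agreeing with one function `Z : ℂ → ℂ` on a right (left) half-plane — sample `s = j`
  (`s = -j`), `j ∈ ℕ` large: the points `T = q^{∓j}` form an infinite set avoiding all poles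
  (`ratFunc_eq_of_eval_eq_on_infinite`, `exists_forall_eval_inv_pow_ne_zero` of
  `GodementJacquetLocal`, and `exists_forall_eval_pow_ne_zero` here).
* `HasRSLFactor.unique`: the `L`-polynomial `P` (`P(0) = 1`) is unique: `P'/P` and `P/P'` are
  Laurent polynomials (`HasRSLFactor.exists_X_pow_mul_eq`, the argument of
  `HasGJLFactor.exists_X_pow_mul_eq`), then `polynomial_eq_of_laurent_unit`.
* `HasRSGamma.unique`: `γ` is unique as soon as an `L`-polynomial exists (which supplies a zeta
  integral `Ψ(s; W, W') ≢ 0`, as `1/P(q^{-s}) ≠ 0` is a combination of zeta integrals) and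
  `V' ≠ 0` (so that the central character of `π'` is well defined).
* `tateEpsilonRat_injective` (`e ≠ 0`), `rsLRatDual_ne_zero` (`P(q⁻¹T⁻¹) ≠ 0` when
  `P(0) ≠ 0`, an order-at-infinity = `RatFunc.intDegree` argument), `HasRSEpsilon.unique` and
  `HasRSEpsilon.existsUnique_of_exists`: `(e, a)` is unique once ONE solution has `e ≠ 0`.
  With `e = 0` every `(0, a')` would do, so the existence half must deliver `e ≠ 0`; in JPSS this
  is "`ε` is a unit of `ℂ[q^{-s}, q^{s}]`", from the functional equation applied twice.

What is NOT here: the existence halves (JPSS 1983, Thm. 2.7: convergence of the integrals via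
gauge estimates on Whittaker functions, rationality via the asymptotics of Whittaker functions,
the functional equation via the Bernstein–Zelevinsky uniqueness of invariant bilinear forms, and
`ε` monomial) — a theory not in the tree; the named facts of `RankinSelbergLocal` keep carrying
it.

## The measure hypotheses of the named facts of `RankinSelbergLocal` (recorded 2026-08-15)

`RankinSelbergLocal` declares `[BorelSpace (GL_m ⧸ U_m)]`, `[SMulInvariantMeasure GL_m (GL_m ⧸ U_m) ν]`,
`[IsFiniteMeasureOnCompacts ν]`, `[ν.IsOpenPosMeasure]`, `[BorelSpace F]`, `[μ.IsAddHaarMeasure]`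
as section `variable`s, but a `def … : Prop` abstracts only the section variables its body
uses, so none of these instance hypotheses became an argument of `existsUnique_hasRSLFactor`,
`existsUnique_hasRSGamma`, `hasRSLFactor_of_isSatakeParameter`, `existsUnique_hasRSEpsilon`,
`hasRSEpsilon_ne_zero` (`#check @existsUnique_hasRSEpsilon` ends
`… (ν : Measure (GL (Fin m) F ⧸ _)) [MeasurableSpace F] (μ : Measure F) : Prop`). As elaborated,
these facts speak about ARBITRARY measures `ν`, `μ` and are false at `ν = 0`:
`not_hasRSLFactor_zero_measure` (all zeta integrals vanish, so `1/P` is no combination of them)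
and `not_hasRSEpsilon_zero_measure` below; and at `μ = 0` with `m (n - m - 1) > 0` the tilde
integrals vanish, forcing `γ = 0`, `e = 0` and non-uniqueness of `a`. The intended — and, by
JPSS Thm. 2.7, true — statements carry these hypotheses inside the `∀`. The theorems of this
file concern the predicates `HasRSLFactor`/`HasRSGamma`/`HasRSEpsilon`, hold for every `ν`, `μ`,
and therefore serve the corrected facts unchanged.

## References

* H. Jacquet, I. I. Piatetski-Shapiro, J. Shalika, *Rankin–Selberg convolutions*, Amer. J. Math.
  105 (1983), 367–464, §2, Thm. 2.7 [JacquetPiatetskiShapiroShalika1983] (held only as a scan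
  without text layer; numbering as recorded in `RankinSelbergLocal`).
* J. W. Cogdell, *Analytic theory of `L`-functions for `GL_n`*, in J. Bernstein, S. Gelbart
  (eds.), *An Introduction to the Langlands Program*, Birkhäuser, §3.1: Thm. 3.1 (the local
  integrals span a `ℂ[q^{s}, q^{-s}]`-fractional ideal with generator `P(q^{-s})⁻¹`, `P(0) = 1`),
  Thm. 3.2 (local functional equation with `ω'(-1)^{n-1} γ(s, π × π', ψ)`), and the paragraph
  after it (`ε = γ L(s, π × π') / L(1 - s, π̃ × π̃')` is a monomial `c q^{-fs}`) (read).
* Mathlib: `RatFunc.eval`, `RatFunc.intDegree` (`intDegree_mul/add_le/C/X/inv/neg`),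
  `Polynomial.X_mul_divX_add`, `Polynomial.mem_roots`, `Nat.lt_pow_self`.
-/

set_option autoImplicit false

open scoped NNReal
open MeasureTheory Polynomial
  Literature.NumberTheory.GaloisRepresentations.IsNonarchimedeanLocalField

noncomputable section

namespace Literature.NumberTheory.Automorphic

/-! ### Sample points `T = q^{∓j}`, `j ∈ ℕ` -/

section Sampling

/-- For `1 < q` and finitely many non-zero polynomials, the points `T = q^{k}` (`k ∈ ℕ` large)
are not roots: the norms of all roots are bounded by some `M`, and `q^k > k > M` eventually.
(Companion of `exists_forall_eval_inv_pow_ne_zero`.) [folklore] -/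
theorem exists_forall_eval_pow_ne_zero {ι : Type*} [Finite ι] {q : ℕ} (hq : 1 < q)
    (p : ι → ℂ[X]) (hp : ∀ i, p i ≠ 0) :
    ∃ k₀ : ℕ, ∀ k, k₀ ≤ k → ∀ i, (p i).eval ((q : ℂ) ^ k) ≠ 0 := by
  classical
  haveI := Fintype.ofFinite ι
  -- a bound for the norms of all roots of all `p i`
  set M : ℝ := ∑ i, ((p i).roots.map (‖·‖)).sum with hM_def
  have hnn : ∀ i, ∀ x ∈ (p i).roots.map (‖·‖), (0 : ℝ) ≤ x := fun i x hx => by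
    obtain ⟨y, -, rfl⟩ := Multiset.mem_map.mp hx
    exact norm_nonneg y
  have hM : ∀ i, ∀ r ∈ (p i).roots, ‖r‖ ≤ M := by
    intro i r hr
    have h1 : ‖r‖ ≤ ((p i).roots.map (‖·‖)).sum :=
      Multiset.single_le_sum (hnn i) _ (Multiset.mem_map_of_mem _ hr)
    have h2 : ((p i).roots.map (‖·‖)).sum ≤ M :=
      Finset.single_le_sum (f := fun i => ((p i).roots.map (‖·‖)).sum)
        (fun j _ => Multiset.sum_nonneg (hnn j)) (Finset.mem_univ i)
    exact h1.trans h2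
  refine ⟨⌈M⌉₊ + 1, fun k hk i hroot => ?_⟩
  have hmem : ((q : ℂ) ^ k) ∈ (p i).roots := (Polynomial.mem_roots (hp i)).mpr hroot
  have h1 := hM i _ hmem
  rw [norm_pow, Complex.norm_natCast] at h1
  have h2 : (k : ℝ) < (q : ℝ) ^ k := by exact_mod_cast Nat.lt_pow_self hq
  have h3 : ((⌈M⌉₊ + 1 : ℕ) : ℝ) ≤ k := by exact_mod_cast hk
  push_cast at h3
  linarith [Nat.le_ceil M]

/-- `j ↦ q^{-j} = (q^j)⁻¹` is injective on `ℕ` for `1 < q`. [folklore] -/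
theorem inv_natCast_pow_injective {q : ℕ} (hq : 1 < q) :
    Function.Injective fun j : ℕ => (((q : ℂ) ^ j)⁻¹) := by
  intro j j' hjj'
  have h1 : ((q : ℂ) ^ j) = (q : ℂ) ^ j' := inv_injective hjj'
  have h2 : ((q ^ j : ℕ) : ℂ) = ((q ^ j' : ℕ) : ℂ) := by push_cast; exact h1
  exact Nat.pow_right_injective hq (Nat.cast_injective h2)

/-- `j ↦ q^{j}` is injective on `ℕ` for `1 < q`. [folklore] -/
theorem natCast_pow_injective {q : ℕ} (hq : 1 < q) :
    Function.Injective fun j : ℕ => ((q : ℂ) ^ j) := by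
  intro j j' hjj'
  have h2 : ((q ^ j : ℕ) : ℂ) = ((q ^ j' : ℕ) : ℂ) := by push_cast; exact hjj'
  exact Nat.pow_right_injective hq (Nat.cast_injective h2)

/-- `evalAtQ q R (-k) = R(q^k)` at a natural number `k` (`q^{-(-k)} = q^k`). [folklore] -/
theorem evalAtQ_neg_natCast (q k : ℕ) (R : RatFunc ℂ) :
    evalAtQ q R (-(k : ℂ)) = R.eval (RingHom.id ℂ) ((q : ℂ) ^ k) := by
  rw [evalAtQ, neg_neg, Complex.cpow_natCast]

/-- **Sample points in a right half-plane.** Given finitely many real abscissas `c_l` and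
finitely many non-zero polynomials `p_i`, every large `j ∈ ℕ` has `re j > c_l` for all `l` and
`p_i(q^{-j}) ≠ 0` for all `i`. [folklore] -/
theorem exists_forall_lt_re_and_eval_ne_zero {ι κ : Type*} [Finite ι] [Finite κ] {q : ℕ}
    (hq : 1 < q) (c : κ → ℝ) (p : ι → ℂ[X]) (hp : ∀ i, p i ≠ 0) :
    ∃ K : ℕ, ∀ j : ℕ, K ≤ j →
      (∀ l, c l < ((j : ℂ)).re) ∧ ∀ i, (p i).eval (((q : ℂ) ^ j)⁻¹) ≠ 0 := by
  classical
  haveI := Fintype.ofFinite κ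
  obtain ⟨k₀, hk₀⟩ := exists_forall_eval_inv_pow_ne_zero hq p hp
  set B : ℝ := ∑ l, max (c l) 0 with hB_def
  have hBc : ∀ l, c l ≤ B := fun l =>
    (le_max_left _ _).trans
      (Finset.single_le_sum (f := fun l => max (c l) 0) (fun j _ => le_max_right _ _)
        (Finset.mem_univ l))
  refine ⟨max (⌈B⌉₊ + 1) k₀, fun j hj => ⟨fun l => ?_, fun i => hk₀ j ((le_max_right _ _).trans hj) i⟩⟩
  have h1 : ((⌈B⌉₊ + 1 : ℕ) : ℝ) ≤ j := by exact_mod_cast (le_max_left _ _).trans hj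
  push_cast at h1
  rw [Complex.natCast_re]
  linarith [hBc l, Nat.le_ceil B]

/-- **Sample points in a left half-plane.** Given finitely many real abscissas `c_l` and
finitely many non-zero polynomials `p_i`, every large `j ∈ ℕ` has `re (-j) < c_l` for all `l`
and `p_i(q^{j}) ≠ 0` for all `i`. [folklore] -/
theorem exists_forall_re_lt_and_eval_ne_zero {ι κ : Type*} [Finite ι] [Finite κ] {q : ℕ}
    (hq : 1 < q) (c : κ → ℝ) (p : ι → ℂ[X]) (hp : ∀ i, p i ≠ 0) :
    ∃ K : ℕ, ∀ j : ℕ, K ≤ j →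
      (∀ l, ((-(j : ℂ))).re < c l) ∧ ∀ i, (p i).eval ((q : ℂ) ^ j) ≠ 0 := by
  classical
  haveI := Fintype.ofFinite κ
  obtain ⟨k₀, hk₀⟩ := exists_forall_eval_pow_ne_zero hq p hp
  set B : ℝ := ∑ l, max (-c l) 0 with hB_def
  have hBc : ∀ l, -c l ≤ B := fun l =>
    (le_max_left _ _).trans
      (Finset.single_le_sum (f := fun l => max (-c l) 0) (fun j _ => le_max_right _ _)
        (Finset.mem_univ l))
  refine ⟨max (⌈B⌉₊ + 1) k₀, fun j hj => ⟨fun l => ?_, fun i => hk₀ j ((le_max_right _ _).trans hj) i⟩⟩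
  have h1 : ((⌈B⌉₊ + 1 : ℕ) : ℝ) ≤ j := by exact_mod_cast (le_max_left _ _).trans hj
  push_cast at h1
  rw [Complex.neg_re, Complex.natCast_re]
  linarith [hBc l, Nat.le_ceil B]

/-- **A rational function is determined by its values on a right half-plane**: if
`Z(s) = R(q^{-s})` for `re s > c` and `Z(s) = R'(q^{-s})` for `re s > c'` (`1 < q`), then
`R = R'` (both agree at the infinitely many points `q^{-j}`, `j ∈ ℕ` large, off all poles).
This is why the `γ`-factor of `HasRSGamma` and the `L`-polynomial of `HasRSLFactor` are pinned
down by the zeta integrals (design note D8 of `RankinSelbergLocal`). [folklore] -/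
theorem EqOnRightHalfPlane.unique {q : ℕ} (hq : 1 < q) {Z : ℂ → ℂ} {R R' : RatFunc ℂ}
    (h : EqOnRightHalfPlane q Z R) (h' : EqOnRightHalfPlane q Z R') : R = R' := by
  obtain ⟨c, hc⟩ := h
  obtain ⟨c', hc'⟩ := h'
  obtain ⟨K, hK⟩ := exists_forall_lt_re_and_eval_ne_zero hq ![c, c'] ![R.denom, R'.denom]
    (fun i => by fin_cases i <;> exact RatFunc.denom_ne_zero _)
  set t : ℕ → ℂ := fun j => ((q : ℂ) ^ j)⁻¹ with ht
  have hS : (t '' Set.Ici K).Infinite :=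
    (Set.Ici_infinite K).image (inv_natCast_pow_injective hq).injOn
  refine ratFunc_eq_of_eval_eq_on_infinite hS ?_ ?_ ?_
  · rintro _ ⟨j, hj, rfl⟩; simpa using (hK j hj).2 0
  · rintro _ ⟨j, hj, rfl⟩; simpa using (hK j hj).2 1
  · rintro _ ⟨j, hj, rfl⟩
    have h0 : c < ((j : ℂ)).re := by simpa using (hK j hj).1 0
    have h1 : c' < ((j : ℂ)).re := by simpa using (hK j hj).1 1
    have e1 := hc _ h0
    have e2 := hc' _ h1
    rw [evalAtQ_natCast] at e1 e2
    rw [← e1, ← e2]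

/-- **A rational function is determined by its values on a left half-plane**: if
`Z(s) = R(q^{-s})` for `re s < c` and `Z(s) = R'(q^{-s})` for `re s < c'` (`1 < q`), then
`R = R'` (sample `s = -j`, `T = q^{j}`, `j ∈ ℕ` large). Used for the contragredient side of the
functional equation in `HasRSGamma`. [folklore] -/
theorem EqOnLeftHalfPlane.unique {q : ℕ} (hq : 1 < q) {Z : ℂ → ℂ} {R R' : RatFunc ℂ}
    (h : EqOnLeftHalfPlane q Z R) (h' : EqOnLeftHalfPlane q Z R') : R = R' := by
  obtain ⟨c, hc⟩ := h
  obtain ⟨c', hc'⟩ := h'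
  obtain ⟨K, hK⟩ := exists_forall_re_lt_and_eval_ne_zero hq ![c, c'] ![R.denom, R'.denom]
    (fun i => by fin_cases i <;> exact RatFunc.denom_ne_zero _)
  set t : ℕ → ℂ := fun j => (q : ℂ) ^ j with ht
  have hS : (t '' Set.Ici K).Infinite :=
    (Set.Ici_infinite K).image (natCast_pow_injective hq).injOn
  refine ratFunc_eq_of_eval_eq_on_infinite hS ?_ ?_ ?_
  · rintro _ ⟨j, hj, rfl⟩; simpa using (hK j hj).2 0
  · rintro _ ⟨j, hj, rfl⟩; simpa using (hK j hj).2 1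
  · rintro _ ⟨j, hj, rfl⟩
    have h0 : (-(j : ℂ)).re < c := by simpa using (hK j hj).1 0
    have h1 : (-(j : ℂ)).re < c' := by simpa using (hK j hj).1 1
    have e1 := hc _ h0
    have e2 := hc' _ h1
    rw [evalAtQ_neg_natCast] at e1 e2
    rw [← e1, ← e2]

/-- If `Z = R` on a right half-plane and `R = 0`, then `Z(s) = 0` for `re s` large. [folklore] -/
theorem EqOnRightHalfPlane.eq_zero_of_eq_zero {q : ℕ} {Z : ℂ → ℂ} {R : RatFunc ℂ}
    (h : EqOnRightHalfPlane q Z R) (hR : R = 0) : ∃ c : ℝ, ∀ s : ℂ, c < s.re → Z s = 0 := by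
  obtain ⟨c, hc⟩ := h
  refine ⟨c, fun s hs => ?_⟩
  rw [hc s hs, hR, evalAtQ, RatFunc.eval_zero]

end Sampling

/-! ### Uniqueness of the `L`-polynomial -/

section LFactor

variable {F : Type*} [Field F] [ValuativeRel F] [TopologicalSpace F] [IsNonarchimedeanLocalField F]
  {n m : ℕ} {V : Type*} [AddCommGroup V] [Module ℂ V] {V' : Type*} [AddCommGroup V'] [Module ℂ V']
  [MeasurableSpace (GL (Fin m) F ⧸ upperUnitriangular (Fin m) F)]
  {hmn : m < n} {π : Representation ℂ (GL (Fin n) F) V} {π' : Representation ℂ (GL (Fin m) F) V'}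
  {ψ : AddChar F Circle} {ν : Measure (GL (Fin m) F ⧸ upperUnitriangular (Fin m) F)}

/-- The `L`-polynomial of `HasRSLFactor` has constant term `1`. [folklore] -/
theorem HasRSLFactor.eval_zero {P : ℂ[X]} (h : HasRSLFactor hmn π π' ψ ν P) : P.eval 0 = 1 :=
  h.1

/-- The `L`-polynomial of `HasRSLFactor` is non-zero. [folklore] -/
theorem HasRSLFactor.ne_zero {P : ℂ[X]} (h : HasRSLFactor hmn π π' ψ ν P) : P ≠ 0 := fun hP => by
  have h0 : P.eval 0 = 1 := h.1
  rw [hP, Polynomial.eval_zero] at h0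
  exact zero_ne_one h0

omit [ValuativeRel F] [TopologicalSpace F] [IsNonarchimedeanLocalField F] in
/-- `L(s) = 1/P(q^{-s})` does not vanish off the poles: `(1/P)(t) ≠ 0` whenever the (reduced)
denominator of `1/P ∈ ℂ(T)` does not vanish at `t` (`(1/P) · P = 1` and `RatFunc.eval_mul`). [folklore] -/
theorem eval_rsLRat_ne_zero {P : ℂ[X]} (hP : P ≠ 0) {t : ℂ}
    (ht : (rsLRat P).denom.eval t ≠ 0) : (rsLRat P).eval (RingHom.id ℂ) t ≠ 0 := by
  intro h0
  have hinj := IsFractionRing.injective ℂ[X] (RatFunc ℂ)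
  have h1 : rsLRat P * algebraMap ℂ[X] (RatFunc ℂ) P = 1 :=
    inv_mul_cancel₀ ((map_ne_zero_iff _ hinj).mpr hP)
  have h2 := congrArg (RatFunc.eval (RingHom.id ℂ) t) h1
  have hx : Polynomial.eval₂ (RingHom.id ℂ) t (rsLRat P).denom ≠ 0 := by
    rwa [Polynomial.eval₂_id]
  have hy : Polynomial.eval₂ (RingHom.id ℂ) t (algebraMap ℂ[X] (RatFunc ℂ) P).denom ≠ 0 := by
    rw [RatFunc.denom_algebraMap, Polynomial.eval₂_one]
    exact one_ne_zero
  rw [RatFunc.eval_mul (RingHom.id ℂ) t hx hy, h0, zero_mul, RatFunc.eval_one] at h2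
  exact zero_ne_one h2

/-- **One direction of the uniqueness of the Rankin–Selberg `L`-polynomial.** If `P` and `P'`
both satisfy `HasRSLFactor hmn π π' ψ ν`, then `X^i P' = a P` for some polynomial `a` and
`i ∈ ℕ`, i.e. `P'/P ∈ ℂ[T, T⁻¹]`: by (b) for `P`, `P(q^{-s})⁻¹ = ∑_i Q_i(s) Ψ_i(s)` on a right
half-plane, and by (a) for `P'` each `Ψ_i = R_i(q^{-s}) / P'(q^{-s})` there with `R_i` Laurent;
comparing at the points `q^{-j}`, `j ∈ ℕ` large, gives `1/P = (∑ Q_i R_i)/P'` in `ℂ(T)`. The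
argument of `HasGJLFactor.exists_X_pow_mul_eq` (Godement–Jacquet) verbatim; Jacquet–
Piatetski-Shapiro–Shalika 1983, Thm. 2.7 (ii) (the ideal of the `Ψ` has a unique generator
`P(q^{-s})⁻¹` with `P(0) = 1`); Cogdell, Thm. 3.1. [cite: JacquetPiatetskiShapiroShalika1983, Thm. 2.7] -/
theorem HasRSLFactor.exists_X_pow_mul_eq {P P' : ℂ[X]} (h : HasRSLFactor hmn π π' ψ ν P)
    (h' : HasRSLFactor hmn π π' ψ ν P') :
    ∃ (a : ℂ[X]) (i : ℕ), (X : ℂ[X]) ^ i * P' = a * P := by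
  classical
  set q : ℕ := residueFieldCard F with hq_def
  have hq : 1 < q := one_lt_residueFieldCard F
  obtain ⟨k, Λ, Λ', v, v', Q, hΛ, hΛ', hQ, c₀, hc₀⟩ := h.2.2
  choose R hR c hc using fun i => h'.2.1 (Λ i) (hΛ i) (Λ' i) (hΛ' i) (v i) (v' i)
  -- the Laurent polynomial `L = ∑ Q_i R_i = Lp / X^e`
  set L : RatFunc ℂ := ∑ i, Q i * R i with hL_def
  obtain ⟨Lp, e, hLe⟩ : IsLaurent L := IsLaurent.sum _ fun i _ => (hQ i).mul (hR i)
  -- the denominators of all rational functions involved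
  let den : (Fin k × Fin 3) ⊕ Fin 4 → ℂ[X] := fun j =>
    match j with
    | Sum.inl (i, 0) => (Q i).denom
    | Sum.inl (i, 1) => (R i).denom
    | Sum.inl (i, 2) => (Q i * R i).denom
    | Sum.inr 0 => (rsLRat P).denom
    | Sum.inr 1 => (rsLRat P').denom
    | Sum.inr 2 => L.denom
    | Sum.inr 3 => (L * rsLRat P').denom
  obtain ⟨K, hK⟩ := exists_forall_lt_re_and_eval_ne_zero hq (Sum.elim (fun _ : Unit => c₀) c)
    den (fun j => by
      rcases j with ⟨i, j⟩ | j
      · fin_cases j <;> exact RatFunc.denom_ne_zero _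
      · fin_cases j <;> exact RatFunc.denom_ne_zero _)
  -- the infinite set of sample points
  set t : ℕ → ℂ := fun j => ((q : ℂ) ^ j)⁻¹ with ht
  have hS : (t '' Set.Ici K).Infinite :=
    (Set.Ici_infinite K).image (inv_natCast_pow_injective hq).injOn
  -- the key identity of rational functions `1/P = L/P'`
  have hkey : rsLRat P = L * rsLRat P' := by
    refine ratFunc_eq_of_eval_eq_on_infinite hS ?_ ?_ ?_
    · rintro _ ⟨j, hj, rfl⟩; exact (hK j hj).2 (Sum.inr 0)
    · rintro _ ⟨j, hj, rfl⟩; exact (hK j hj).2 (Sum.inr 3)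
    · rintro _ ⟨j, hj, rfl⟩
      obtain ⟨hjc, hden⟩ := hK j hj
      have hjc₀ : c₀ < ((j : ℂ)).re := hjc (Sum.inl ())
      have e2 : ∀ l, Polynomial.eval₂ (RingHom.id ℂ) (t j) (den l) ≠ 0 := fun l => by
        rw [Polynomial.eval₂_id]; exact hden l
      have lhs := hc₀ (j : ℂ) hjc₀
      dsimp only at lhs
      rw [← hq_def, evalAtQ_natCast] at lhs
      -- `∑ Q_i(s) Ψ_i(s) = (∑ Q_i R_i)(t) * (1/P')(t)` at `s = j`
      have step : ∑ i, evalAtQ q (Q i) (j : ℂ) *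
          rsZeta hmn ν (whittakerModel π (Λ i) (v i)) (whittakerModel π' (Λ' i) (v' i)) (j : ℂ) =
          (L * rsLRat P').eval (RingHom.id ℂ) (t j) := by
        have hsum := ratFunc_eval_finset_sum_of_denom_ne_zero Finset.univ (fun i => Q i * R i)
          (t j) (fun i _ => hden (Sum.inl (i, 2)))
        rw [RatFunc.eval_mul (RingHom.id ℂ) (t j) (e2 (Sum.inr 2)) (e2 (Sum.inr 1)), hsum.1,
          Finset.sum_mul]
        refine Finset.sum_congr rfl fun i _ => ?_
        have hci := hc i (j : ℂ) (hjc (Sum.inr i))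
        rw [← hq_def] at hci
        rw [hci, evalAtQ_natCast, evalAtQ_natCast,
          RatFunc.eval_mul (RingHom.id ℂ) (t j) (e2 (Sum.inl (i, 1))) (e2 (Sum.inr 1)),
          RatFunc.eval_mul (RingHom.id ℂ) (t j) (e2 (Sum.inl (i, 0))) (e2 (Sum.inl (i, 1))),
          mul_assoc]
      rw [← lhs, step]
  -- clear denominators: `X^e * P' = Lp * P`
  refine ⟨Lp, e, ?_⟩
  have hinj := IsFractionRing.injective ℂ[X] (RatFunc ℂ)
  have hP : (algebraMap ℂ[X] (RatFunc ℂ) P) ≠ 0 := (map_ne_zero_iff _ hinj).mpr h.ne_zero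
  have hP' : (algebraMap ℂ[X] (RatFunc ℂ) P') ≠ 0 := (map_ne_zero_iff _ hinj).mpr h'.ne_zero
  have hXe : (RatFunc.X : RatFunc ℂ) ^ e ≠ 0 := pow_ne_zero _ RatFunc.X_ne_zero
  apply hinj
  rw [map_mul, map_mul, map_pow, RatFunc.algebraMap_X]
  rw [rsLRat, rsLRat, hLe] at hkey
  field_simp at hkey
  linear_combination hkey

/-- **Uniqueness of the local Rankin–Selberg `L`-polynomial** (Jacquet–Piatetski-Shapiro–Shalika
1983, Thm. 2.7 (ii): the fractional ideal spanned by the `Ψ(s; W, W')` has a unique generator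
`P(q^{-s})⁻¹` with `P(0) = 1`; Cogdell, Thm. 3.1): two polynomials with `HasRSLFactor hmn π π' ψ ν`
coincide — `P'/P`, `P/P'` are Laurent polynomials (`HasRSLFactor.exists_X_pow_mul_eq`) and
`polynomial_eq_of_laurent_unit`. Holds for any measure `ν`. [cite: JacquetPiatetskiShapiroShalika1983, Thm. 2.7] -/
theorem HasRSLFactor.unique {P P' : ℂ[X]} (h : HasRSLFactor hmn π π' ψ ν P)
    (h' : HasRSLFactor hmn π π' ψ ν P') : P = P' := by
  obtain ⟨a, i, ha⟩ := h.exists_X_pow_mul_eq h'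
  obtain ⟨b, j, hb⟩ := h'.exists_X_pow_mul_eq h
  exact polynomial_eq_of_laurent_unit h.eval_zero h'.eval_zero ha hb

/-- The existence half suffices for `existsUnique_hasRSLFactor`: given an `L`-polynomial, it is
the unique one (`HasRSLFactor.unique`). [folklore] -/
theorem HasRSLFactor.existsUnique_of_exists (h : ∃ P : ℂ[X], HasRSLFactor hmn π π' ψ ν P) :
    ∃! P : ℂ[X], HasRSLFactor hmn π π' ψ ν P := by
  obtain ⟨P, hP⟩ := h
  exact ⟨P, hP, fun P' hP' => hP'.unique hP⟩

/-- **Some zeta integral does not vanish.** If `P` is an `L`-polynomial (`HasRSLFactor`) and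
`R_i ∈ ℂ(T)` interpolate the zeta integrals `Ψ(s; W_i, W'_i)` of the data of clause (b) on right
half-planes, then some `R_i ≠ 0`: otherwise `1/P(q^{-j}) = ∑ Q_i(j) · 0 = 0` for `j` large,
while `1/P(t) ≠ 0` off the poles. [folklore] -/
theorem HasRSLFactor.exists_ratFunc_ne_zero {P : ℂ[X]} (h : HasRSLFactor hmn π π' ψ ν P)
    {k : ℕ} {Λ : Fin k → Module.Dual ℂ V} {Λ' : Fin k → Module.Dual ℂ V'} {v : Fin k → V}
    {v' : Fin k → V'} {Q : Fin k → RatFunc ℂ}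
    (hb : EqOnRightHalfPlane (residueFieldCard F)
      (fun s => ∑ i, evalAtQ (residueFieldCard F) (Q i) s *
        rsZeta hmn ν (whittakerModel π (Λ i) (v i)) (whittakerModel π' (Λ' i) (v' i)) s)
      (rsLRat P))
    {R : Fin k → RatFunc ℂ}
    (hR : ∀ i, EqOnRightHalfPlane (residueFieldCard F)
      (rsZeta hmn ν (whittakerModel π (Λ i) (v i)) (whittakerModel π' (Λ' i) (v' i))) (R i)) :
    ∃ i, R i ≠ 0 := by
  classical
  by_contra hall
  push Not at hall
  have hq : 1 < residueFieldCard F := one_lt_residueFieldCard F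
  obtain ⟨c₀, hc₀⟩ := hb
  choose c hc using fun i => (hR i).eq_zero_of_eq_zero (hall i)
  obtain ⟨K, hK⟩ := exists_forall_lt_re_and_eval_ne_zero hq (Sum.elim (fun _ : Unit => c₀) c)
    (fun _ : Unit => (rsLRat P).denom) (fun _ => RatFunc.denom_ne_zero _)
  obtain ⟨hKc, hKd⟩ := hK K le_rfl
  have h1 := hc₀ (K : ℂ) (hKc (Sum.inl ()))
  dsimp only at h1
  have h2 : ∀ i, rsZeta hmn ν (whittakerModel π (Λ i) (v i)) (whittakerModel π' (Λ' i) (v' i))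
      (K : ℂ) = 0 := fun i => hc i (K : ℂ) (hKc (Sum.inr i))
  simp only [h2, mul_zero, Finset.sum_const_zero] at h1
  rw [evalAtQ_natCast] at h1
  exact eval_rsLRat_ne_zero h.ne_zero (hKd ()) h1.symm

/-- **The named facts of `RankinSelbergLocal` at the zero measure.** No polynomial is an
`L`-polynomial for `ν = 0`: all zeta integrals `rsZeta hmn 0 W W' s = ∫ … ∂0` vanish, so clause
(b) of `HasRSLFactor` would give `1/P(q^{-s}) = 0` for `re s` large. Hence
`existsUnique_hasRSLFactor hmn π π' ψ 0`, which (its invariance/positivity hypotheses on `ν`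
being section instances NOT captured by the `def`) quantifies over `ν = 0` too, fails as soon as
its hypotheses on `π, π', ψ` are met — the facts need `ν` to be the invariant measure, as their
docstrings say. [folklore] -/
theorem not_hasRSLFactor_zero_measure {P : ℂ[X]} :
    ¬ HasRSLFactor hmn π π' ψ (0 : Measure (GL (Fin m) F ⧸ upperUnitriangular (Fin m) F)) P := by
  intro h
  obtain ⟨k, Λ, Λ', v, v', Q, -, -, -, hb⟩ := h.2.2
  have hR : ∀ i : Fin k, EqOnRightHalfPlane (residueFieldCard F)
      (rsZeta hmn (0 : Measure (GL (Fin m) F ⧸ upperUnitriangular (Fin m) F))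
        (whittakerModel π (Λ i) (v i)) (whittakerModel π' (Λ' i) (v' i))) 0 := fun i =>
    ⟨0, fun s _ => by simp [rsZeta, evalAtQ]⟩
  obtain ⟨i, hi⟩ := h.exists_ratFunc_ne_zero hb hR
  exact hi rfl

end LFactor

/-! ### Uniqueness of the `γ`-factor -/

section Gamma

variable {F : Type*} [Field F] [ValuativeRel F] [TopologicalSpace F] [IsNonarchimedeanLocalField F]
  {n m : ℕ} {V : Type*} [AddCommGroup V] [Module ℂ V] {V' : Type*} [AddCommGroup V'] [Module ℂ V']
  [MeasurableSpace (GL (Fin m) F ⧸ upperUnitriangular (Fin m) F)]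
  {hmn : m < n} {π : Representation ℂ (GL (Fin n) F) V} {π' : Representation ℂ (GL (Fin m) F) V'}
  {ψ : AddChar F Circle} {ν : Measure (GL (Fin m) F ⧸ upperUnitriangular (Fin m) F)}
  [MeasurableSpace F] {μ : Measure F}

omit [ValuativeRel F] [TopologicalSpace F] [IsNonarchimedeanLocalField F]
  [MeasurableSpace (GL (Fin m) F ⧸ upperUnitriangular (Fin m) F)] [MeasurableSpace F] in
/-- A central character is unique on a non-zero space: if every `z ∈ Z(GL_m)` acts as both
`ω z` and `ω' z` on `V' ≠ 0`, then `ω z = ω' z`. (Schur; Bernstein–Zelevinsky 1976, §2.10.) [folklore] -/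
theorem hasCentralCharacter_apply_eq [Nontrivial V'] {ω ω' : Subgroup.center (GL (Fin m) F) →* ℂˣ}
    (hω : π'.HasCentralCharacter ω) (hω' : π'.HasCentralCharacter ω')
    (z : Subgroup.center (GL (Fin m) F)) : ω z = ω' z := by
  obtain ⟨x, hx⟩ := exists_ne (0 : V')
  have h1 := hω.apply z x
  rw [hω'.apply z x] at h1
  exact Units.val_injective (smul_left_injective ℂ hx h1).symm

/-- **Uniqueness of the local Rankin–Selberg `γ`-factor** (Jacquet–Piatetski-Shapiro–Shalika 1983,
Thm. 2.7 (iii); Cogdell, Thm. 3.2): if `π × π'` has an `L`-polynomial (`HasRSLFactor`, which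
supplies a zeta integral `Ψ(s; W, W') ≢ 0`, `HasRSLFactor.exists_ratFunc_ne_zero`) and `V' ≠ 0`,
then at most one `γ ∈ ℂ(T)` satisfies the functional equation `HasRSGamma`: for the data of a
non-vanishing `Ψ = R(q^{-s})`, both `γ` and `γ'` give `R̃ = ω_{π'}(-1)^{n-1} γ R = ω_{π'}(-1)^{n-1} γ' R`
with the same `R`, `R̃` (`EqOnRightHalfPlane.unique`, `EqOnLeftHalfPlane.unique`) and the same
`ω_{π'}` (`hasCentralCharacter_apply_eq`), whence `γ = γ'`. [cite: JacquetPiatetskiShapiroShalika1983, Thm. 2.7] -/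
theorem HasRSGamma.unique [Nontrivial V'] {P : ℂ[X]} (hP : HasRSLFactor hmn π π' ψ ν P)
    {γ γ' : RatFunc ℂ} (h : HasRSGamma hmn π π' ψ μ ν γ) (h' : HasRSGamma hmn π π' ψ μ ν γ') :
    γ = γ' := by
  classical
  have hq : 1 < residueFieldCard F := one_lt_residueFieldCard F
  obtain ⟨ω, hω, H⟩ := h
  obtain ⟨ω', hω', H'⟩ := h'
  obtain ⟨k, Λ, Λ', v, v', Q, hΛ, hΛ', -, hb⟩ := hP.2.2
  choose R Rt hR hRt hE using fun i => H (Λ i) (hΛ i) (Λ' i) (hΛ' i) (v i) (v' i)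
  choose R' Rt' hR' hRt' hE' using fun i => H' (Λ i) (hΛ i) (Λ' i) (hΛ' i) (v i) (v' i)
  obtain ⟨i, hi⟩ := hP.exists_ratFunc_ne_zero hb hR
  have hu : ω (centerNegOne m F) = ω' (centerNegOne m F) := hasCentralCharacter_apply_eq hω hω' _
  have e1 := hE i
  have e2 := hE' i
  rw [← (hRt i).unique hq (hRt' i), ← (hR i).unique hq (hR' i), ← hu, e1] at e2
  have hC : RatFunc.C ((((ω (centerNegOne m F)) : ℂˣ) : ℂ) ^ (n - 1)) ≠ 0 :=
    (_root_.map_ne_zero RatFunc.C).mpr (pow_ne_zero _ (Units.ne_zero _))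
  exact mul_left_cancel₀ hC (mul_right_cancel₀ hi e2)

/-- The existence half suffices for `existsUnique_hasRSGamma` (given the `L`-polynomial of
JPSS Thm. 2.7 (ii) and `V' ≠ 0`): a `γ`-factor, once it exists, is unique (`HasRSGamma.unique`). [folklore] -/
theorem HasRSGamma.existsUnique_of_exists [Nontrivial V'] {P : ℂ[X]}
    (hP : HasRSLFactor hmn π π' ψ ν P) (h : ∃ γ : RatFunc ℂ, HasRSGamma hmn π π' ψ μ ν γ) :
    ∃! γ : RatFunc ℂ, HasRSGamma hmn π π' ψ μ ν γ := by
  obtain ⟨γ, hγ⟩ := h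
  exact ⟨γ, hγ, fun γ' hγ' => HasRSGamma.unique hP hγ' hγ⟩

end Gamma

/-! ### Monomials `e T^a` and the substitution `T ↦ q⁻¹ T⁻¹` -/

section Epsilon

/-- `intDegree (X ^ a) = a` for an integer exponent (`intDegree X = 1`, multiplicativity). [folklore] -/
theorem intDegree_X_zpow (a : ℤ) : ((RatFunc.X : RatFunc ℂ) ^ a).intDegree = a := by
  have hnat : ∀ k : ℕ, ((RatFunc.X : RatFunc ℂ) ^ k).intDegree = k := by
    intro k
    induction k with
    | zero => simp
    | succ k ih =>
      rw [pow_succ, RatFunc.intDegree_mul (pow_ne_zero _ RatFunc.X_ne_zero) RatFunc.X_ne_zero, ih,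
        RatFunc.intDegree_X]
      push_cast
      ring
  cases a with
  | ofNat k => rw [Int.ofNat_eq_natCast, zpow_natCast, hnat]
  | negSucc k =>
    rw [zpow_negSucc, RatFunc.intDegree_inv, hnat, Int.negSucc_eq]
    push_cast
    ring

/-- `intDegree (y ^ k) = k · intDegree y` for `y ≠ 0`. [folklore] -/
theorem intDegree_pow_of_ne_zero {y : RatFunc ℂ} (hy : y ≠ 0) (k : ℕ) :
    (y ^ k).intDegree = k * y.intDegree := by
  induction k with
  | zero => simp
  | succ k ih =>
    rw [pow_succ, RatFunc.intDegree_mul (pow_ne_zero _ hy) hy, ih]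
    push_cast
    ring

/-- The `ε`-monomial `e T^a` is non-zero for `e ≠ 0`. [folklore] -/
theorem tateEpsilonRat_ne_zero {e : ℂ} (he : e ≠ 0) (a : ℤ) : tateEpsilonRat e a ≠ 0 :=
  mul_ne_zero ((_root_.map_ne_zero RatFunc.C).mpr he) (zpow_ne_zero _ RatFunc.X_ne_zero)

/-- **The monomial data `(e, a)` of an `ε`-factor are determined by the rational function
`e T^a`** when `e ≠ 0`: compare `intDegree` (`= a`) and cancel `T^a`. (With `e = 0` all
`(0, a')` give the same rational function `0`.) [folklore] -/
theorem tateEpsilonRat_injective {e e' : ℂ} {a a' : ℤ} (he : e ≠ 0)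
    (h : tateEpsilonRat e a = tateEpsilonRat e' a') : e = e' ∧ a = a' := by
  have he' : e' ≠ 0 := by
    rintro rfl
    refine tateEpsilonRat_ne_zero he a ?_
    rw [h, tateEpsilonRat, map_zero, zero_mul]
  have hdeg := congrArg RatFunc.intDegree h
  rw [tateEpsilonRat, tateEpsilonRat,
    RatFunc.intDegree_mul ((_root_.map_ne_zero RatFunc.C).mpr he) (zpow_ne_zero _ RatFunc.X_ne_zero),
    RatFunc.intDegree_mul ((_root_.map_ne_zero RatFunc.C).mpr he') (zpow_ne_zero _ RatFunc.X_ne_zero),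
    RatFunc.intDegree_C, RatFunc.intDegree_C, intDegree_X_zpow, intDegree_X_zpow, zero_add,
    zero_add] at hdeg
  subst hdeg
  refine ⟨RatFunc.C_injective (mul_right_cancel₀ (zpow_ne_zero a RatFunc.X_ne_zero) ?_), rfl⟩
  simpa only [tateEpsilonRat] using h

/-- Substituting a rational function of non-positive `intDegree` (order at `∞` ≥ 0) into a
polynomial yields `intDegree ≤ 0` (when the result is non-zero): induction over monomials with
`intDegree_mul`, `intDegree_add_le`. [folklore] -/
theorem intDegree_aeval_nonpos {y : RatFunc ℂ} (hy : y.intDegree ≤ 0) (p : ℂ[X])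
    (hp : Polynomial.aeval y p ≠ 0) : (Polynomial.aeval y p).intDegree ≤ 0 := by
  induction p using Polynomial.induction_on' with
  | add p r ihp ihr =>
    rw [map_add] at hp ⊢
    by_cases h1 : Polynomial.aeval y p = 0
    · rw [h1, zero_add] at hp ⊢
      exact ihr hp
    by_cases h2 : Polynomial.aeval y r = 0
    · rw [h2, add_zero] at hp ⊢
      exact ihp h1
    exact (RatFunc.intDegree_add_le h2 hp).trans (max_le (ihp h1) (ihr h2))
  | monomial k c =>
    rw [Polynomial.aeval_monomial, RatFunc.algebraMap_eq_C] at hp ⊢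
    have hc : RatFunc.C c ≠ 0 := left_ne_zero_of_mul hp
    have hyk : y ^ k ≠ 0 := right_ne_zero_of_mul hp
    rw [RatFunc.intDegree_mul hc hyk, RatFunc.intDegree_C, zero_add]
    by_cases hy0 : y = 0
    · subst hy0
      cases k with
      | zero => simp
      | succ k => exact absurd (zero_pow (Nat.succ_ne_zero k)) hyk
    rw [intDegree_pow_of_ne_zero hy0]
    exact mul_nonpos_iff.mpr (Or.inl ⟨Nat.cast_nonneg k, hy⟩)

/-- **`P(y) ≠ 0` for `P(0) ≠ 0` and `y` of negative order at infinity** (`intDegree y < 0`, e.g.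
`y = q⁻¹ T⁻¹`): write `P = X · P.divX + P(0)`; then `y · P.divX(y)` has negative `intDegree`
unless it vanishes, so it cannot cancel the non-zero constant `P(0)`. [folklore] -/
theorem aeval_ne_zero_of_intDegree_lt_zero {y : RatFunc ℂ} (hy : y.intDegree < 0) {p : ℂ[X]}
    (hp : p.eval 0 ≠ 0) : Polynomial.aeval y p ≠ 0 := by
  intro h0
  have h1 : Polynomial.aeval y p = y * Polynomial.aeval y p.divX + RatFunc.C (p.coeff 0) := by
    conv_lhs => rw [← Polynomial.X_mul_divX_add p]
    rw [map_add, map_mul, Polynomial.aeval_X, Polynomial.aeval_C, RatFunc.algebraMap_eq_C]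
  rw [h1] at h0
  have hc0 : p.coeff 0 ≠ 0 := by rwa [Polynomial.coeff_zero_eq_eval_zero]
  have hC : RatFunc.C (p.coeff 0) ≠ 0 := (_root_.map_ne_zero RatFunc.C).mpr hc0
  by_cases hZ : Polynomial.aeval y p.divX = 0
  · rw [hZ, mul_zero, zero_add] at h0
    exact hC h0
  have hy0 : y ≠ 0 := by
    rintro rfl
    simp at hy
  have h2 : y * Polynomial.aeval y p.divX = -RatFunc.C (p.coeff 0) := eq_neg_of_add_eq_zero_left h0
  have h3 := congrArg RatFunc.intDegree h2
  rw [RatFunc.intDegree_mul hy0 hZ, RatFunc.intDegree_neg, RatFunc.intDegree_C] at h3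
  have h4 := intDegree_aeval_nonpos hy.le p.divX hZ
  omega

variable {F : Type*} [Field F] [ValuativeRel F] [TopologicalSpace F] [IsNonarchimedeanLocalField F]

/-- `P(q⁻¹ T⁻¹) ≠ 0` in `ℂ(T)` whenever `P(0) ≠ 0` (`q⁻¹ T⁻¹ = dualVar F` has `intDegree = -1`). [folklore] -/
theorem aeval_dualVar_ne_zero {P : ℂ[X]} (hP : P.eval 0 ≠ 0) :
    Polynomial.aeval (dualVar F) P ≠ 0 := by
  refine aeval_ne_zero_of_intDegree_lt_zero ?_ hP
  have hq : ((residueFieldCard F : ℂ))⁻¹ ≠ 0 :=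
    inv_ne_zero (Nat.cast_ne_zero.mpr (residueFieldCard_ne_zero F))
  rw [dualVar, RatFunc.intDegree_mul ((_root_.map_ne_zero RatFunc.C).mpr hq) (inv_ne_zero RatFunc.X_ne_zero),
    RatFunc.intDegree_C, RatFunc.intDegree_inv, RatFunc.intDegree_X]
  norm_num

/-- The dual `L`-factor `L(1 - s) = P(q⁻¹ T⁻¹)⁻¹ ∈ ℂ(T)` is non-zero when `P(0) ≠ 0`. [folklore] -/
theorem rsLRatDual_ne_zero {P : ℂ[X]} (hP : P.eval 0 ≠ 0) : rsLRatDual F P ≠ 0 :=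
  inv_ne_zero (aeval_dualVar_ne_zero hP)

omit [ValuativeRel F] [TopologicalSpace F] [IsNonarchimedeanLocalField F] in
/-- The `L`-factor `L(s) = P(T)⁻¹ ∈ ℂ(T)` is non-zero when `P ≠ 0`. [folklore] -/
theorem rsLRat_ne_zero {P : ℂ[X]} (hP : P ≠ 0) : rsLRat P ≠ 0 :=
  inv_ne_zero ((map_ne_zero_iff _ (IsFractionRing.injective ℂ[X] (RatFunc ℂ))).mpr hP)

variable {n m : ℕ} {V : Type*} [AddCommGroup V] [Module ℂ V] {V' : Type*} [AddCommGroup V']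
  [Module ℂ V'] [MeasurableSpace (GL (Fin m) F ⧸ upperUnitriangular (Fin m) F)]
  {hmn : m < n} {π : Representation ℂ (GL (Fin n) F) V} {π' : Representation ℂ (GL (Fin m) F) V'}
  {ψ : AddChar F Circle} {ν : Measure (GL (Fin m) F ⧸ upperUnitriangular (Fin m) F)}
  [MeasurableSpace F] {μ : Measure F}

/-- **Uniqueness of the local Rankin–Selberg `ε`-factor as monomial data** (Jacquet–
Piatetski-Shapiro–Shalika 1983, Thm. 2.7 (iii); Cogdell, §3.1, `ε(s, π × π', ψ) = e q^{-as}`):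
if `HasRSEpsilon hmn π π' ψ μ ν e a` holds with `e ≠ 0` and also `HasRSEpsilon … e' a'`, then
`(e, a) = (e', a')`. The `L`-polynomials `P`, `P̃` of the two solutions agree
(`HasRSLFactor.unique`, for `(π, π')` and for the contragredient pair), the `γ`-factors
`ε · L̃/L` agree (`HasRSGamma.unique`), `L̃/L ≠ 0` (`rsLRatDual_ne_zero`, `rsLRat_ne_zero`),
and `e T^a` determines `(e, a)` (`tateEpsilonRat_injective`). [cite: JacquetPiatetskiShapiroShalika1983, Thm. 2.7] -/
theorem HasRSEpsilon.unique [Nontrivial V'] {e e' : ℂ} {a a' : ℤ} (he : e ≠ 0)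
    (h : HasRSEpsilon hmn π π' ψ μ ν e a) (h' : HasRSEpsilon hmn π π' ψ μ ν e' a') :
    e = e' ∧ a = a' := by
  obtain ⟨P, Pt, hP, hPt, hγ⟩ := h
  obtain ⟨P', Pt', hP', hPt', hγ'⟩ := h'
  obtain rfl : P = P' := hP.unique hP'
  obtain rfl : Pt = Pt' := hPt.unique hPt'
  have hγγ := HasRSGamma.unique hP hγ hγ'
  have hD : rsLRatDual F Pt / rsLRat P ≠ 0 :=
    div_ne_zero (rsLRatDual_ne_zero (by rw [hPt.eval_zero]; exact one_ne_zero))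
      (rsLRat_ne_zero hP.ne_zero)
  refine tateEpsilonRat_injective he (mul_right_cancel₀ hD ?_)
  simpa only [mul_div_assoc] using hγγ

/-- **The existence half suffices for `existsUnique_hasRSEpsilon`.** If some `(e, a)` with
`e ≠ 0` satisfies `HasRSEpsilon` (the content of JPSS 1983, Thm. 2.7: `L`-factors of `(π, π')`
and `(π̃, π̃')`, the functional equation, and `ε` a unit monomial) and `V' ≠ 0`, then
`∃! (e, a)`. [folklore] -/
theorem HasRSEpsilon.existsUnique_of_exists [Nontrivial V']
    (h : ∃ (e : ℂ) (a : ℤ), e ≠ 0 ∧ HasRSEpsilon hmn π π' ψ μ ν e a) :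
    ∃! ea : ℂ × ℤ, HasRSEpsilon hmn π π' ψ μ ν ea.1 ea.2 := by
  obtain ⟨e, a, he, hea⟩ := h
  refine ⟨(e, a), hea, fun ea' h' => ?_⟩
  obtain ⟨h1, h2⟩ := hea.unique he h'
  exact Prod.ext h1.symm h2.symm

/-- `HasRSEpsilon.existsUnique_of_exists` in the setting of the named fact
`existsUnique_hasRSEpsilon` (`π'` irreducible, hence `V' ≠ 0`): the fact reduces to the
existence of `(e, a)` with `e ≠ 0`. [folklore] -/
theorem HasRSEpsilon.existsUnique_of_exists_of_isIrreducible [π'.IsIrreducible]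
    (h : ∃ (e : ℂ) (a : ℤ), e ≠ 0 ∧ HasRSEpsilon hmn π π' ψ μ ν e a) :
    ∃! ea : ℂ × ℤ, HasRSEpsilon hmn π π' ψ μ ν ea.1 ea.2 :=
  haveI : Nontrivial V' :=
    Literature.RepresentationTheory.Semisimple.Representation.nontrivial_of_isIrreducible π'
  HasRSEpsilon.existsUnique_of_exists h

/-- **The named fact at the zero measure.** `HasRSEpsilon hmn π π' ψ μ 0 e a` never holds
(`not_hasRSLFactor_zero_measure`), so `existsUnique_hasRSEpsilon hmn π π' ψ 0 μ` — which, its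
measure hypotheses being section instances not captured by the `def`, does quantify over
`ν = 0` — fails whenever its hypotheses on `π, π', ψ` are met. [folklore] -/
theorem not_hasRSEpsilon_zero_measure {e : ℂ} {a : ℤ} :
    ¬ HasRSEpsilon hmn π π' ψ μ (0 : Measure (GL (Fin m) F ⧸ upperUnitriangular (Fin m) F)) e a :=
  fun ⟨_, _, hP, _, _⟩ => not_hasRSLFactor_zero_measure hP

end Epsilon

end Literature.NumberTheory.Automorphic
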